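import Literature.Barriers.CriticalPhenomena.PlanarEdwardsModelDiffusiveSILTBounds
import Mathlib.Analysis.Real.Pi.Bounds
import HarnessLib

/-!
# Mollified self-intersection local time of planar Brownian motion: `∫_{[0,1]⁴} Φ_{k,l} ≤ 57`
# uniformly in `k, l` (Varadhan's second-moment computation, step 3)

Continues `PlanarEdwardsModelDiffusiveSILTBounds`: the dominant
`(1/8π²) (a + 1/k)^{-1/2} (|s∧t - u∧v| + 1/k)^{-3/4} (|s∨t - u∨v| + 1/l)^{-3/4}` of the covariance
density `Φ_{k,l} = Edwards2D.covDensity k l` (`covDensity_le_dominant`) is integrated over the unit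
4-cube by Fubini: symmetrising in `(u, v)` splits the last two factors
(`integral_inner_le`: `≤ 2 · 16 · 16`), the first factor integrates to `≤ 8`
(`integral_outer_le`), each by the one-dimensional bound `∫₀¹ (|x - c| + ε)^r dx ≤ 4/(r+1)`;
hence `∫_{[0,1]⁴} Φ_{k,l} ≤ 512/π² ≤ 57` for all `k, l` (**`integral_covDensity_le`**), the uniform
variance bound `Var(T_k) ≤ 57` behind the `L²` convergence of the centred `T_k`.

No probability enters this file.

## References

* S. R. S. Varadhan, Appendix to K. Symanzik, *Euclidean quantum field theory* (1969) (the
  second-moment method; not consulted). The elementary estimates here are ours. [folklore]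
-/

noncomputable section

open MeasureTheory Real Filter Set Function
open scoped NNReal ENNReal Topology

namespace Literature.Barriers.CriticalPhenomena

namespace Edwards2D

open Literature.Probability.Process

/-! ### The unit square -/

/-- `unitSq` is Lebesgue measure restricted to `[0,1]²`. [folklore] -/
theorem unitSq_eq_restrict :
    unitSq = (volume.prod volume : Measure (ℝ × ℝ)).restrict (Icc (0 : ℝ) 1 ×ˢ Icc (0 : ℝ) 1) := by
  rw [unitSq, Measure.prod_restrict]

/-- Almost every point of `unitSq` lies in `[0,1]²`. [folklore] -/
theorem ae_mem_unitSq : ∀ᵐ p : ℝ × ℝ ∂unitSq, p.1 ∈ Icc (0 : ℝ) 1 ∧ p.2 ∈ Icc (0 : ℝ) 1 := by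
  rw [unitSq_eq_restrict]
  filter_upwards [ae_restrict_mem (measurableSet_Icc.prod measurableSet_Icc)] with p hp
  exact ⟨hp.1, hp.2⟩

/-- The clamp `x ↦ (x.toNNReal : ℝ) = max x 0` is continuous. [folklore] -/
theorem continuous_clamp : Continuous fun x : ℝ => ((x.toNNReal : ℝ≥0) : ℝ) :=
  NNReal.continuous_coe.comp continuous_real_toNNReal

/-- On `[0,1]` the clamp is the identity. [folklore] -/
theorem clamp_eq_self {x : ℝ} (hx : x ∈ Icc (0 : ℝ) 1) : ((x.toNNReal : ℝ≥0) : ℝ) = x :=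
  Real.coe_toNNReal x hx.1

/-- A negative power of `(nonnegative) + ε` is at most `ε` to that power. [folklore] -/
theorem add_rpow_le_rpow {y ε r : ℝ} (hy : 0 ≤ y) (hε : 0 < ε) (hr : r ≤ 0) : (y + ε) ^ r ≤ ε ^ r :=
  Real.rpow_le_rpow_of_nonpos hε (by linarith) hr

/-! ### The inner integral: symmetrisation in `(u, v)` -/

/-- **Inner bound**: for `s₁, t₁ ∈ [0,1]` and `εk, εl ∈ (0,1]`,
`∫_{[0,1]²} (|s₁ - u∧v| + εk)^{-3/4} (|t₁ - u∨v| + εl)^{-3/4} du dv ≤ 512`: the integrand is at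
most `G(u,v) + G(v,u)` with `G(u,v) = (|s₁ - u| + εk)^{-3/4}(|t₁ - v| + εl)^{-3/4}`, whose integral
factorises into two one-dimensional integrals `≤ 16` each. [folklore] -/
theorem integral_inner_le {s₁ t₁ εk εl : ℝ} (hs : s₁ ∈ Icc (0 : ℝ) 1) (ht : t₁ ∈ Icc (0 : ℝ) 1)
    (hεk : 0 < εk) (hεk1 : εk ≤ 1) (hεl : 0 < εl) (hεl1 : εl ≤ 1) :
    ∫ q : ℝ × ℝ, (|s₁ - min ((q.1.toNNReal : ℝ≥0) : ℝ) q.2.toNNReal| + εk) ^ (-(3 / 4) : ℝ) *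
        (|t₁ - max ((q.1.toNNReal : ℝ≥0) : ℝ) q.2.toNNReal| + εl) ^ (-(3 / 4) : ℝ) ∂unitSq ≤ 512 := by
  set r : ℝ := -(3 / 4) with hr
  have hr0 : r ≤ 0 := by norm_num [hr]
  have hr1 : -1 < r := by norm_num [hr]
  -- the product function `G`
  set G : ℝ × ℝ → ℝ := fun q => (|s₁ - ((q.1.toNNReal : ℝ≥0) : ℝ)| + εk) ^ r *
    (|t₁ - ((q.2.toNNReal : ℝ≥0) : ℝ)| + εl) ^ r with hG
  have hGnn : ∀ q, 0 ≤ G q := fun q => by rw [hG]; positivity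
  have hGle : ∀ q, G q ≤ εk ^ r * εl ^ r := fun q => by
    rw [hG]
    exact mul_le_mul (add_rpow_le_rpow (abs_nonneg _) hεk hr0)
      (add_rpow_le_rpow (abs_nonneg _) hεl hr0) (by positivity) (by positivity)
  have hGcont : Continuous G := by
    rw [hG]
    refine Continuous.mul ?_ ?_
    · refine Continuous.rpow_const ?_ fun q => Or.inl (by positivity)
      exact ((continuous_const.sub (continuous_clamp.comp continuous_fst)).abs).add continuous_const
    · refine Continuous.rpow_const ?_ fun q => Or.inl (by positivity)
      exact ((continuous_const.sub (continuous_clamp.comp continuous_snd)).abs).add continuous_const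
  have hGint : Integrable G unitSq :=
    Integrable.of_bound hGcont.aestronglyMeasurable (εk ^ r * εl ^ r)
      (ae_of_all _ fun q => by rw [Real.norm_eq_abs, abs_of_nonneg (hGnn q)]; exact hGle q)
  have hGint' : Integrable (fun q : ℝ × ℝ => G q.swap) unitSq :=
    Integrable.of_bound (hGcont.comp continuous_swap).aestronglyMeasurable (εk ^ r * εl ^ r)
      (ae_of_all _ fun q => by rw [Real.norm_eq_abs, abs_of_nonneg (hGnn _)]; exact hGle _)
  -- pointwise symmetrisation
  have hpt : ∀ q : ℝ × ℝ,
      (|s₁ - min ((q.1.toNNReal : ℝ≥0) : ℝ) q.2.toNNReal| + εk) ^ r *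
        (|t₁ - max ((q.1.toNNReal : ℝ≥0) : ℝ) q.2.toNNReal| + εl) ^ r ≤ G q + G q.swap := by
    intro q
    rcases le_total ((q.1.toNNReal : ℝ≥0) : ℝ) q.2.toNNReal with h | h
    · rw [min_eq_left h, max_eq_right h]
      exact le_add_of_nonneg_right (hGnn _)
    · rw [min_eq_right h, max_eq_left h]
      have : (|s₁ - ((q.2.toNNReal : ℝ≥0) : ℝ)| + εk) ^ r * (|t₁ - ((q.1.toNNReal : ℝ≥0) : ℝ)| + εl) ^ r =
          G q.swap := by rw [hG]; simp only [Prod.fst_swap, Prod.snd_swap]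
      rw [this]
      exact le_add_of_nonneg_left (hGnn _)
  -- integrability of the left-hand side (continuous and bounded)
  have hLcont : Continuous fun q : ℝ × ℝ =>
      (|s₁ - min ((q.1.toNNReal : ℝ≥0) : ℝ) q.2.toNNReal| + εk) ^ r *
        (|t₁ - max ((q.1.toNNReal : ℝ≥0) : ℝ) q.2.toNNReal| + εl) ^ r := by
    refine Continuous.mul ?_ ?_
    · refine Continuous.rpow_const ?_ fun q => Or.inl (by positivity)
      exact ((continuous_const.sub ((continuous_clamp.comp continuous_fst).min
        (continuous_clamp.comp continuous_snd))).abs).add continuous_const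
    · refine Continuous.rpow_const ?_ fun q => Or.inl (by positivity)
      exact ((continuous_const.sub ((continuous_clamp.comp continuous_fst).max
        (continuous_clamp.comp continuous_snd))).abs).add continuous_const
  have hLint : Integrable (fun q : ℝ × ℝ =>
      (|s₁ - min ((q.1.toNNReal : ℝ≥0) : ℝ) q.2.toNNReal| + εk) ^ r *
        (|t₁ - max ((q.1.toNNReal : ℝ≥0) : ℝ) q.2.toNNReal| + εl) ^ r) unitSq := by
    refine Integrable.of_bound hLcont.aestronglyMeasurable (εk ^ r * εl ^ r + εk ^ r * εl ^ r)
      (ae_of_all _ fun q => ?_)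
    rw [Real.norm_eq_abs, abs_of_nonneg (by positivity)]
    exact (hpt q).trans (add_le_add (hGle _) (hGle _))
  -- the two one-dimensional integrals
  have h1 : ∫ u in Icc (0 : ℝ) 1, (|s₁ - ((u.toNNReal : ℝ≥0) : ℝ)| + εk) ^ r ≤ 16 := by
    have h := (integral_abs_clamp_sub_add_rpow_le hr1 hr0 hεk hεk1 hs.1 hs.2).2
    norm_num [hr] at h ⊢
    exact h
  have h2 : ∫ v in Icc (0 : ℝ) 1, (|t₁ - ((v.toNNReal : ℝ≥0) : ℝ)| + εl) ^ r ≤ 16 := by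
    have h := (integral_abs_clamp_sub_add_rpow_le hr1 hr0 hεl hεl1 ht.1 ht.2).2
    norm_num [hr] at h ⊢
    exact h
  have h1nn : 0 ≤ ∫ u in Icc (0 : ℝ) 1, (|s₁ - ((u.toNNReal : ℝ≥0) : ℝ)| + εk) ^ r :=
    integral_nonneg fun u => by positivity
  have hGI : ∫ q, G q ∂unitSq ≤ 256 := by
    rw [hG, unitSq, integral_prod_mul (μ := volume.restrict (Icc (0 : ℝ) 1))
      (ν := volume.restrict (Icc (0 : ℝ) 1)) (fun u : ℝ => (|s₁ - ((u.toNNReal : ℝ≥0) : ℝ)| + εk) ^ r)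
      (fun v : ℝ => (|t₁ - ((v.toNNReal : ℝ≥0) : ℝ)| + εl) ^ r)]
    calc _ ≤ (16 : ℝ) * 16 := mul_le_mul h1 h2 (integral_nonneg fun v => by positivity) (by norm_num)
      _ = 256 := by norm_num
  have hGI' : ∫ q : ℝ × ℝ, G q.swap ∂unitSq = ∫ q, G q ∂unitSq := by
    rw [unitSq]
    exact integral_prod_swap G
  calc _ ≤ ∫ q, G q + G q.swap ∂unitSq := integral_mono hLint (hGint.add hGint') hpt
    _ = (∫ q, G q ∂unitSq) + ∫ q : ℝ × ℝ, G q.swap ∂unitSq := integral_add hGint hGint'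
    _ ≤ 256 + 256 := by rw [hGI']; exact add_le_add hGI hGI
    _ = 512 := by norm_num

/-! ### The outer integral -/

/-- **Outer bound**: `∫_{[0,1]²} (|t - s| + ε)^{-1/2} ds dt ≤ 8` for `ε ∈ (0,1]`. [folklore] -/
theorem integral_outer_le {ε : ℝ} (hε : 0 < ε) (hε1 : ε ≤ 1) :
    ∫ p : ℝ × ℝ, (|((p.2.toNNReal : ℝ≥0) : ℝ) - p.1.toNNReal| + ε) ^ (-(1 / 2) : ℝ) ∂unitSq ≤ 8 := by
  set r : ℝ := -(1 / 2) with hr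
  have hr0 : r ≤ 0 := by norm_num [hr]
  have hr1 : -1 < r := by norm_num [hr]
  set F : ℝ × ℝ → ℝ := fun p => (|((p.2.toNNReal : ℝ≥0) : ℝ) - p.1.toNNReal| + ε) ^ r with hF
  have hFcont : Continuous F := by
    rw [hF]
    refine Continuous.rpow_const ?_ fun q => Or.inl (by positivity)
    exact (((continuous_clamp.comp continuous_snd).sub (continuous_clamp.comp continuous_fst)).abs).add
      continuous_const
  have hFint : Integrable F unitSq :=
    Integrable.of_bound hFcont.aestronglyMeasurable (ε ^ r) (ae_of_all _ fun p => by
      rw [hF, Real.norm_eq_abs, abs_of_nonneg (by positivity)]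
      exact add_rpow_le_rpow (abs_nonneg _) hε hr0)
  have hI := isProbabilityMeasure_restrict_unitInterval
  change ∫ p, F p ∂unitSq ≤ 8
  rw [unitSq, integral_prod F (by rw [← unitSq]; exact hFint)]
  have hinner : ∀ s ∈ Icc (0 : ℝ) 1, ∫ t in Icc (0 : ℝ) 1, F (s, t) ≤ 8 := by
    intro s hs
    rw [hF]
    simp only [clamp_eq_self hs]
    have h := (integral_abs_clamp_sub_add_rpow_le hr1 hr0 hε hε1 hs.1 hs.2).1
    norm_num [hr] at h ⊢
    exact h
  have hIint : Integrable (fun s => ∫ t in Icc (0 : ℝ) 1, F (s, t)) (volume.restrict (Icc (0 : ℝ) 1)) := by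
    have h := hFint.integral_prod_left (μ := volume.restrict (Icc (0 : ℝ) 1))
      (ν := volume.restrict (Icc (0 : ℝ) 1))
    rw [unitSq] at hFint
    exact hFint.integral_prod_left
  calc ∫ s in Icc (0 : ℝ) 1, ∫ t in Icc (0 : ℝ) 1, F (s, t)
      ≤ ∫ _s in Icc (0 : ℝ) 1, (8 : ℝ) := by
        refine integral_mono_ae hIint (integrable_const _) ?_
        filter_upwards [ae_restrict_mem measurableSet_Icc] with s hs
        exact hinner s hs
    _ = 8 := by simp

/-! ### The four-dimensional bound -/

/-- The dominant of `covDensity_le_dominant` is continuous. [folklore] -/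
theorem continuous_dominant (k l : ℕ) (hk : 1 ≤ k) (hl : 1 ≤ l) :
    Continuous fun pq : (ℝ × ℝ) × (ℝ × ℝ) => 1 / (8 * π ^ 2) *
      ((|((pq.1.2.toNNReal : ℝ≥0) : ℝ) - pq.1.1.toNNReal| + 1 / k) ^ (-(1 / 2) : ℝ) *
        ((|min ((pq.1.1.toNNReal : ℝ≥0) : ℝ) pq.1.2.toNNReal -
              min ((pq.2.1.toNNReal : ℝ≥0) : ℝ) pq.2.2.toNNReal| + 1 / k) ^ (-(3 / 4) : ℝ) *
          (|max ((pq.1.1.toNNReal : ℝ≥0) : ℝ) pq.1.2.toNNReal -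
              max ((pq.2.1.toNNReal : ℝ≥0) : ℝ) pq.2.2.toNNReal| + 1 / l) ^ (-(3 / 4) : ℝ))) := by
  have hk0 : (0 : ℝ) < 1 / k := by positivity
  have hl0 : (0 : ℝ) < 1 / l := by positivity
  have c11 : Continuous fun pq : (ℝ × ℝ) × (ℝ × ℝ) => ((pq.1.1.toNNReal : ℝ≥0) : ℝ) :=
    continuous_clamp.comp (continuous_fst.comp continuous_fst)
  have c12 : Continuous fun pq : (ℝ × ℝ) × (ℝ × ℝ) => ((pq.1.2.toNNReal : ℝ≥0) : ℝ) :=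
    continuous_clamp.comp (continuous_snd.comp continuous_fst)
  have c21 : Continuous fun pq : (ℝ × ℝ) × (ℝ × ℝ) => ((pq.2.1.toNNReal : ℝ≥0) : ℝ) :=
    continuous_clamp.comp (continuous_fst.comp continuous_snd)
  have c22 : Continuous fun pq : (ℝ × ℝ) × (ℝ × ℝ) => ((pq.2.2.toNNReal : ℝ≥0) : ℝ) :=
    continuous_clamp.comp (continuous_snd.comp continuous_snd)
  refine continuous_const.mul (Continuous.mul ?_ (Continuous.mul ?_ ?_))
  · exact Continuous.rpow_const (((c12.sub c11).abs).add continuous_const)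
      fun q => Or.inl (by positivity)
  · exact Continuous.rpow_const ((((c11.min c12).sub (c21.min c22)).abs).add continuous_const)
      fun q => Or.inl (by positivity)
  · exact Continuous.rpow_const ((((c11.max c12).sub (c21.max c22)).abs).add continuous_const)
      fun q => Or.inl (by positivity)

/-- **`∫_{[0,1]⁴}` of the dominant is at most `512/π² ≤ 57`** (Fubini: `integral_inner_le` for
a.e. `(s,t)`, then `integral_outer_le`). [folklore] -/
theorem integral_dominant_le (k l : ℕ) (hk : 1 ≤ k) (hl : 1 ≤ l) :
    ∫ pq : (ℝ × ℝ) × (ℝ × ℝ), 1 / (8 * π ^ 2) *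
      ((|((pq.1.2.toNNReal : ℝ≥0) : ℝ) - pq.1.1.toNNReal| + 1 / k) ^ (-(1 / 2) : ℝ) *
        ((|min ((pq.1.1.toNNReal : ℝ≥0) : ℝ) pq.1.2.toNNReal -
              min ((pq.2.1.toNNReal : ℝ≥0) : ℝ) pq.2.2.toNNReal| + 1 / k) ^ (-(3 / 4) : ℝ) *
          (|max ((pq.1.1.toNNReal : ℝ≥0) : ℝ) pq.1.2.toNNReal -
              max ((pq.2.1.toNNReal : ℝ≥0) : ℝ) pq.2.2.toNNReal| + 1 / l) ^ (-(3 / 4) : ℝ)))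
      ∂(unitSq.prod unitSq) ≤ 57 := by
  have hk0 : (0 : ℝ) < 1 / k := by positivity
  have hl0 : (0 : ℝ) < 1 / l := by positivity
  have hk1 : (1 : ℝ) / k ≤ 1 := by
    rw [div_le_one (by exact_mod_cast hk)]; exact_mod_cast hk
  have hl1 : (1 : ℝ) / l ≤ 1 := by
    rw [div_le_one (by exact_mod_cast hl)]; exact_mod_cast hl
  -- name the pieces
  set C : ℝ := 1 / (8 * π ^ 2) with hC
  set fA : ℝ × ℝ → ℝ := fun p => (|((p.2.toNNReal : ℝ≥0) : ℝ) - p.1.toNNReal| + 1 / k) ^ (-(1 / 2) : ℝ)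
    with hfA
  set K : ℝ × ℝ → ℝ × ℝ → ℝ := fun p q =>
    (|min ((p.1.toNNReal : ℝ≥0) : ℝ) p.2.toNNReal - min ((q.1.toNNReal : ℝ≥0) : ℝ) q.2.toNNReal| + 1 / k)
        ^ (-(3 / 4) : ℝ) *
      (|max ((p.1.toNNReal : ℝ≥0) : ℝ) p.2.toNNReal - max ((q.1.toNNReal : ℝ≥0) : ℝ) q.2.toNNReal| + 1 / l)
        ^ (-(3 / 4) : ℝ) with hK
  set D : (ℝ × ℝ) × (ℝ × ℝ) → ℝ := fun pq => C * (fA pq.1 * K pq.1 pq.2) with hD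
  have hDeq : (fun pq : (ℝ × ℝ) × (ℝ × ℝ) => 1 / (8 * π ^ 2) *
      ((|((pq.1.2.toNNReal : ℝ≥0) : ℝ) - pq.1.1.toNNReal| + 1 / k) ^ (-(1 / 2) : ℝ) *
        ((|min ((pq.1.1.toNNReal : ℝ≥0) : ℝ) pq.1.2.toNNReal -
              min ((pq.2.1.toNNReal : ℝ≥0) : ℝ) pq.2.2.toNNReal| + 1 / k) ^ (-(3 / 4) : ℝ) *
          (|max ((pq.1.1.toNNReal : ℝ≥0) : ℝ) pq.1.2.toNNReal -
              max ((pq.2.1.toNNReal : ℝ≥0) : ℝ) pq.2.2.toNNReal| + 1 / l) ^ (-(3 / 4) : ℝ)))) = D := by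
    funext pq
    simp only [hD, hfA, hK, hC]
  have hCpos : 0 < C := by rw [hC]; positivity
  have hfAnn : ∀ p, 0 ≤ fA p := fun p => by rw [hfA]; positivity
  have hKnn : ∀ p q, 0 ≤ K p q := fun p q => by rw [hK]; positivity
  have hfAle : ∀ p, fA p ≤ (1 / k) ^ (-(1 / 2) : ℝ) := fun p => by
    rw [hfA]; exact add_rpow_le_rpow (abs_nonneg _) hk0 (by norm_num)
  have hKle : ∀ p q, K p q ≤ (1 / k) ^ (-(3 / 4) : ℝ) * (1 / l) ^ (-(3 / 4) : ℝ) := fun p q => by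
    rw [hK]
    exact mul_le_mul (add_rpow_le_rpow (abs_nonneg _) hk0 (by norm_num))
      (add_rpow_le_rpow (abs_nonneg _) hl0 (by norm_num)) (by positivity) (by positivity)
  have hDcont : Continuous D := by
    have h := continuous_dominant k l hk hl
    rw [hDeq] at h
    exact h
  set M : ℝ := C * ((1 / k) ^ (-(1 / 2) : ℝ) * ((1 / k) ^ (-(3 / 4) : ℝ) * (1 / l) ^ (-(3 / 4) : ℝ)))
  have hDle : ∀ pq, ‖D pq‖ ≤ M := fun pq => by
    rw [hD]
    dsimp only
    rw [Real.norm_eq_abs, abs_of_nonneg (by positivity)]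
    exact mul_le_mul_of_nonneg_left (mul_le_mul (hfAle _) (hKle _ _) (hKnn _ _) (by positivity))
      hCpos.le
  have hDint : Integrable D (unitSq.prod unitSq) :=
    Integrable.of_bound hDcont.aestronglyMeasurable M (ae_of_all _ hDle)
  rw [integral_prod D hDint]
  -- inner bound for a.e. `p`
  have hinner : ∀ᵐ p ∂unitSq, ∫ q, D (p, q) ∂unitSq ≤ C * (fA p * 512) := by
    filter_upwards [ae_mem_unitSq] with p hp
    have hs1 : min ((p.1.toNNReal : ℝ≥0) : ℝ) p.2.toNNReal ∈ Icc (0 : ℝ) 1 := by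
      rw [clamp_eq_self hp.1, clamp_eq_self hp.2]
      exact ⟨le_min hp.1.1 hp.2.1, min_le_of_left_le hp.1.2⟩
    have ht1 : max ((p.1.toNNReal : ℝ≥0) : ℝ) p.2.toNNReal ∈ Icc (0 : ℝ) 1 := by
      rw [clamp_eq_self hp.1, clamp_eq_self hp.2]
      exact ⟨le_max_of_le_left hp.1.1, max_le hp.1.2 hp.2.2⟩
    have hKI := integral_inner_le hs1 ht1 hk0 hk1 hl0 hl1
    rw [hD]
    dsimp only
    rw [integral_const_mul, integral_const_mul]
    refine mul_le_mul_of_nonneg_left (mul_le_mul_of_nonneg_left ?_ (hfAnn p)) hCpos.le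
    rw [hK]
    exact hKI
  have hIint : Integrable (fun p => ∫ q, D (p, q) ∂unitSq) unitSq := hDint.integral_prod_left
  have hfAcont : Continuous fA := by
    rw [hfA]
    refine Continuous.rpow_const ?_ fun q => Or.inl (by positivity)
    exact (((continuous_clamp.comp continuous_snd).sub (continuous_clamp.comp continuous_fst)).abs).add
      continuous_const
  have hfAint : Integrable fA unitSq :=
    Integrable.of_bound hfAcont.aestronglyMeasurable _ (ae_of_all _ fun p => by
      rw [Real.norm_eq_abs, abs_of_nonneg (hfAnn p)]; exact hfAle p)
  have hBint : Integrable (fun p => C * (fA p * 512)) unitSq := (hfAint.mul_const _).const_mul _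
  have houter := integral_outer_le hk0 hk1
  have hpi : (512 : ℝ) / π ^ 2 ≤ 57 := by
    rw [div_le_iff₀ (by positivity)]
    nlinarith [Real.pi_gt_three]
  calc ∫ p, ∫ q, D (p, q) ∂unitSq ∂unitSq ≤ ∫ p, C * (fA p * 512) ∂unitSq :=
        integral_mono_ae hIint hBint hinner
    _ = C * 512 * ∫ p, fA p ∂unitSq := by
        rw [integral_const_mul, integral_mul_const]; ring
    _ ≤ C * 512 * 8 := by
        refine mul_le_mul_of_nonneg_left ?_ (by positivity)
        rw [hfA]
        exact houter
    _ = 512 / π ^ 2 := by rw [hC]; field_simp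
    _ ≤ 57 := hpi

/-- `covDensity k l` is integrable on `[0,1]⁴` (continuous in the clamped times would do; here:
measurable and bounded by `kl/(2π)²`). [folklore] -/
theorem integrable_covDensity (k l : ℕ) : Integrable (covDensity k l) (unitSq.prod unitSq) := by
  refine Integrable.of_bound ?_ ((k : ℝ) / (2 * π) * (l / (2 * π)))
    (ae_of_all _ fun pq => norm_covDensity_le k l pq)
  refine Measurable.aestronglyMeasurable ?_
  unfold covDensity
  simp only [Real.coe_toNNReal']
  refine Measurable.mul measurable_const (Measurable.sub ?_ ?_)
  · refine Measurable.div measurable_const ?_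
    fun_prop
  · refine Measurable.div measurable_const ?_
    fun_prop

/-- **Uniform bound on the covariance density**: `∫_{[0,1]⁴} Φ_{k,l} ≤ 57` for all `k, l` (the
variance bound `Var(T_k) ≤ 57` uniformly in `k`). [folklore] -/
theorem integral_covDensity_le (k l : ℕ) : ∫ pq, covDensity k l pq ∂(unitSq.prod unitSq) ≤ 57 := by
  rcases Nat.eq_zero_or_pos k with hk0 | hk0
  · subst hk0
    have : covDensity 0 l = fun _ => 0 := by funext pq; rw [covDensity_def]; simp
    rw [this]
    simp
  rcases Nat.eq_zero_or_pos l with hl0 | hl0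
  · subst hl0
    have : covDensity k 0 = fun _ => 0 := by funext pq; rw [covDensity_def]; simp
    rw [this]
    simp
  calc ∫ pq, covDensity k l pq ∂(unitSq.prod unitSq) ≤ _ :=
        integral_mono (integrable_covDensity k l) ?_ fun pq => covDensity_le_dominant k l pq hk0 hl0
    _ ≤ 57 := integral_dominant_le k l hk0 hl0
  have hcont := continuous_dominant k l hk0 hl0
  have hk0' : (0 : ℝ) < 1 / k := by positivity
  have hl0' : (0 : ℝ) < 1 / l := by positivity
  refine Integrable.of_bound hcont.aestronglyMeasurable
    (1 / (8 * π ^ 2) * ((1 / k) ^ (-(1 / 2) : ℝ) * ((1 / k) ^ (-(3 / 4) : ℝ) * (1 / l) ^ (-(3 / 4) : ℝ))))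
    (ae_of_all _ fun pq => ?_)
  rw [Real.norm_eq_abs, abs_of_nonneg (by positivity)]
  refine mul_le_mul_of_nonneg_left ?_ (by positivity)
  refine mul_le_mul (add_rpow_le_rpow (abs_nonneg _) hk0' (by norm_num))
    (mul_le_mul (add_rpow_le_rpow (abs_nonneg _) hk0' (by norm_num))
      (add_rpow_le_rpow (abs_nonneg _) hl0' (by norm_num)) (by positivity) (by positivity))
    (by positivity) (by positivity)

end Edwards2D

end Literature.Barriers.CriticalPhenomena
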